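import Literature.MathematicalPhysics.QuantumFieldTheory.Balaban1983to89.B1Ineq225DerivZeroFieldTorus
import Literature.MathematicalPhysics.QuantumFieldTheory.Balaban1983to89.B4Thm19ZeroTorus

/-!
# `Balaban1983to89.B1Ineq224ZeroFieldTorus` — T. Bałaban, *(Higgs)₂,₃ quantum fields in a finite volume. I. A lower bound*,
# Commun. Math. Phys. **85** (1982) 603–626 [Balaban1982Higgs1]: Prop. 2.1 (2.24), THE HÖLDER CLAUSE — `|x − x′|^{−α}|U(A(Γ_{x,x′}))
# (D^ε_{A,μ}G^ε_kf)(x′) − (D^ε_{A,μ}G^ε_kf)(x)| ≦ c₀(α)·(scale)·exp(−δ₀(L^kε)^{−1}dist({x,x′}, supp f))‖f‖_∞`, `0 ≦ α < 1` — PROVED FOR THE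
# (Higgs)₂,₃ MODEL AT ZERO FIELD AT EVERY LEVEL `1 ≦ k ≦ K`, every coupling, every `N`, distances in units of `L^kε`, with ONE `δ₀` and
# one `c₀(α)` for all volumes of the torus sub-family `M·L′_μ = L^m`, all levels and all `L^kε ≦ ε₀` (from B4's Theorem (1.9) on the torus,
# p38's `B4Thm19ZeroTorus.holder_row_bound`, run under a mass cap)

statement-level skeleton of published theorems with citation tags; proofs where landed; nothing here is a claim about the Yang–Mills mass gap

PDF held: `paper:balaban1982-cmp85-higgs23-i` (journal page = PDF page + 602); p. 604 [PDF 2] ((1.3)–(1.4)), p. 605 [PDF 3] ((1.7)),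
p. 610 [PDF 8] (Prop. 2.1 (2.24)); ×2 renders `run/shared/lean/pub/pub-balaban/b2b-balaban-ref1/pages/1982-cmp85-higgs23-I/1982-cmp85-higgs23-I-p008-x2.png`;
B4 = [Balaban1983RegularityDecay] p. 573 [PDF 3] (Theorem (1.9)), p. 582 [PDF 12] (Lemma 2.4), held `paper:balaban1983-cmp89-regularity-decay`.

CITATION HEADER (lean-in-tree rule).  Cell `lit-balaban` (HOME `run/shared/lean/pub/lit-balaban/`), Phase-2 proof seat **p14** gen 9 (unit
`lit-balaban-p14`), companion of `B1Ineq225ZeroFieldTorusLevels` / `B1Ineq225DerivZeroFieldTorus`; SKELETON row **B1.Prop2.1** ((2.24) Hölder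
clause, ruled range `0 ≦ α < 1`, `A = 0`, torus, every level: MODEL INSTANCE on the (Higgs)₂,₃ carrier).  USED BY NAME, never restated: p38's
`B4Thm19ZeroTorus.{holder_row_bound, KerBounds.mono}`, `B4Thm110ZeroTorus.kerBounds_torus`, `B4Lemma24TorusScales.holder236_torus`,
`B4Ineq116Torus.spacing_le_spacing`, gen 8's `B1Ineq225ZeroFieldTorus.{G0unit_decay_cap, norm_le_sqrt_mul}`, `B5Leaf237C0Torus.{gamma0, dK0}`,
`B5Ineq137Torus.{T, dXU}`, this seat's `setupAt`, `eSiteAt`, `cmpAt`, `T_eSiteAt`, `eps_setupAt_mul`, `abs_cmpAt_le`, `sderiv_propagatorK_apply_at`,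
the typer's `HiggsLattice.{covDeriv, covDeriv_zero, Site.tdist}`, `HiggsCovariance.propagatorK`.

WHAT IS PRINTED (verbatim).  p. 610 [PDF 8], Prop. 2.1: *"Then for e(L^kε) sufficiently small and α < 1 there exist positive constants δ₀,
c₀, R₀ independent of A, k, Ω and depending on d, a, M only, c₀ on α also, such that for an arbitrary function f : Ω → R^N we have"* (2.24)
⟦the display is largely illegible on the held scan; by pv07's kernel comparison `B1.prop21Printed_iff_thmPrinted` it is, after the rescaling
(2.22), B4's (1.9)⟧; B4 p. 573 [PDF 3]: *"(1/|x − x′|^α)|U(A(Γ_{x,x′}))(D^η_{A,μ}G_k(Ω,A)f)(x′) − (D^η_{A,μ}G_k(Ω,A)f)(x)| ≦ c₀exp(−δ₀dist({x,x′},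
supp f))‖f‖_∞ (1.9)"*; *"For some simple sets Ω, e.g. for rectangular parallelepipeds, the inequalities hold without any restrictions on the
points x, x′"*.

WHAT THIS FILE PROVES (kernel-checked, zero `sorry`, theorems only; axioms standard).
* §1 **B4 (1.9) ON THE TORUS, TOP LEVEL, UNIFORM UNDER A MASS CAP**: `torus_holder_decay_bound` — ONE `δ₀ > 0` and for every `0 ≦ α < 1` one
  `c₀(α) > 0` with `(ε|x₁−x₂|_T)^{−α}|(∂^ε_μG_Kf)(x₂) − (∂^ε_μG_Kf)(x₁)| ≦ c₀e^{−δ₀εD}F` for every volume `(m, K ≧ 1)`, every mass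
  `0 ≦ m² ≦ m₊²`, all `x₁ ≠ x₂`, every `f` with `|f| ≦ F` vanishing within fine sup-distance `D ≧ 0` of `x₁` and of `x₂` (p38's
  `thm19_zero_torus` run with the mass-capped inputs `kerBounds_torus`, `holder236_torus`, gen 8's `G0unit_decay_cap`).
* §2 **(2.24) FOR THE MODEL AT `A = 0`, EVERY LEVEL**: `covDeriv_propagatorK_holder_bound` — for `d ≧ 1`, odd `L > 1`, `a > 0`, `m² ≧ 0`,
  `ε₀`, `N`: one `δ₀ > 0` and for every `0 ≦ α < 1` one `c₀ > 0` with
  `(|x₁−x₂|/L^k)^{−α}·‖(D^ε_0G^ε_kg)(⟨x₂, x₂+εe_μ⟩) − (D^ε_0G^ε_kg)(⟨x₁, x₁+εe_μ⟩)‖ ≦ c₀(L^kε)e^{−δ₀D/L^k}M` on every torus of the sub-family,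
  every coupling, every `1 ≦ k ≦ K` with `L^kε ≦ ε₀`, all sites `x₁ ≠ x₂`, every `g` with `‖g‖ ≦ M` vanishing within (1.3)-distance `D` of
  `x₁` and of `x₂` (`|x₁−x₂|` = (1.3) in lattice units of `T_ε`, so `|x₁−x₂|/L^k` is the distance in units of `L^kε`: in physical units the
  bound reads `|x₁−x₂|_ε^{−α}‖…‖ ≦ c₀(L^kε)^{1−α}…`; `U(A(Γ)) = 1` at `A = 0`).
HONEST SCOPE: `A = 0` (hence any coupling), `Ω = T_ε`, tori with `M·L′_μ = L^m` and `L` odd, levels `1 ≦ k ≦ K`, ruled Hölder range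
`0 ≦ α < 1` (the literal «α < 1» fails, `B4Thm19ZeroBoxNegAlpha`); constants existential (functions of `d, L, a, m²ε₀², N`, `c₀` also of `α`);
background fields NOT covered.  Unit `lit-balaban-p14` gen 9 (literature-prover-lit-balaban-p14-g9-0).
-/

open scoped BigOperators
open Matrix

namespace Literature.MathematicalPhysics.QuantumFieldTheory.Balaban1983to89.B1Ineq224ZeroFieldTorus

open Literature.MathematicalPhysics.QuantumFieldTheory.Balaban1983to89.HiggsLattice (ChargeData covDeriv covDeriv_zero)
open Literature.MathematicalPhysics.QuantumFieldTheory.Balaban1983to89.HiggsCovariance (propagatorK)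
open Literature.MathematicalPhysics.QuantumFieldTheory.Balaban1983to89.B1RG242Torus (tower deriv)
open Literature.MathematicalPhysics.QuantumFieldTheory.Balaban1983to89.B5Display136Torus (G0unit K1)
open Literature.MathematicalPhysics.QuantumFieldTheory.Balaban1983to89.B5Ineq137Torus (T T_nonneg dXU dXU_nonneg)
open Literature.MathematicalPhysics.QuantumFieldTheory.Balaban1983to89.B5Leaf237C0Torus (gamma0 dK0 gamma0_pos dK0_pos)
open Literature.MathematicalPhysics.QuantumFieldTheory.Balaban1983to89.B4Thm110ZeroTorus (KerBounds kerBounds_torus)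
open Literature.MathematicalPhysics.QuantumFieldTheory.Balaban1983to89.B4Thm19ZeroTorus (holder_row_bound)
open Literature.MathematicalPhysics.QuantumFieldTheory.Balaban1983to89.B4Ineq116Torus (spacing_le_spacing)
open Literature.MathematicalPhysics.QuantumFieldTheory.Balaban1983to89.B1Eq211ZeroFieldTorus (Shape)
open Literature.MathematicalPhysics.QuantumFieldTheory.Balaban1983to89.B1Ineq225ZeroFieldTorus (G0unit_decay_cap norm_le_sqrt_mul)
open Literature.MathematicalPhysics.QuantumFieldTheory.Balaban1983to89.B1Eq211ZeroFieldTorusLevels (setupAt setupAt_d setupAt_L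
  eSiteAt cmpAt cmpAt_apply)
open Literature.MathematicalPhysics.QuantumFieldTheory.Balaban1983to89.B1Eq220ZeroFieldTorusLevels (T_eSiteAt T_eq_tdist_symm)
open Literature.MathematicalPhysics.QuantumFieldTheory.Balaban1983to89.B1Ineq225ZeroFieldTorusLevels (abs_cmpAt_le eps_setupAt_mul)
open Literature.MathematicalPhysics.QuantumFieldTheory.Balaban1983to89.B1Ineq225DerivZeroFieldTorus (sderiv_propagatorK_apply_at)

variable {P : HiggsLattice.Params}

/-! ## §1 B4 (1.9) on the torus, top level, uniform in the volume and under a mass cap -/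

section Torus

/-- **B4 THEOREM (1.9) ON THE TORUS AT `A = 0`, TOP LEVEL, UNIFORM IN THE VOLUME AND UNDER A MASS CAP, `0 ≦ α < 1`**: for `d ≧ 1`, odd `L > 1`,
`a > 0` and `m₊² ≧ 0` there is `δ₀ > 0` and, for every `0 ≦ α < 1`, a `c₀ = c₀(α) > 0` such that for every volume `(m, K ≧ 1)` of Bałaban's
scalar torus tower (top level = unit lattice, `ε = L^{−K}`), every mass `0 ≦ m² ≦ m₊²`, every direction, all fine sites `x₁ ≠ x₂` and every `f`
with `|f| ≦ F` vanishing within fine sup-distance `D ≧ 0` of both: `(ε|x₁−x₂|_T)^{−α}|(∂^ε_μG_Kf)(x₂) − (∂^ε_μG_Kf)(x₁)| ≦ c₀e^{−δ₀εD}F` —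
p38's `thm19_zero_torus`, re-run with the mass-capped inputs. [cite: Balaban1983RegularityDecay, Theorem (1.9) p.573; Lemma 2.4, (2.34)–(2.39) p.582] -/
theorem torus_holder_decay_bound (d L : ℕ) (hd : 1 ≤ d) (hL : Odd L ∧ 1 < L) {a : ℝ} (ha : 0 < a) {m2plus : ℝ}
    (hm2 : 0 ≤ m2plus) :
    ∃ δ₀ : ℝ, 0 < δ₀ ∧ ∀ {α : ℝ}, 0 ≤ α → α < 1 → ∃ c₀ : ℝ, 0 < c₀ ∧ ∀ (Q : Params), Q.d = d → Q.L = L → 1 ≤ Q.K →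
      ∀ (msq : ℝ), 0 ≤ msq → msq ≤ m2plus → ∀ (μ : Fin Q.d) (x₁ x₂ : Site Q 0), x₂ ≠ x₁ →
        ∀ (f : Site Q 0 → ℝ) (F D : ℝ), (∀ z, |f z| ≤ F) → 0 ≤ D →
          (∀ z, f z ≠ 0 → D ≤ T Q 0 x₁ z) → (∀ z, f z ≠ 0 → D ≤ T Q 0 x₂ z) →
            ((Q.eps * T Q 0 x₁ x₂)⁻¹) ^ α *
                |((deriv Q 0 Q.eps μ * (tower Q a msq).G Q.K) *ᵥ f) x₂ -
                  ((deriv Q 0 Q.eps μ * (tower Q a msq).G Q.K) *ᵥ f) x₁|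
              ≤ c₀ * Real.exp (-(δ₀ * (Q.eps * D))) * F := by
  obtain ⟨C, δK, hC, hδK, hK⟩ := kerBounds_torus d L hd hL ha m2plus
  obtain ⟨δH, hδH, hH⟩ := B4Lemma24TorusScales.holder236_torus d L hd hL ha m2plus
  obtain ⟨δ, hδK', hδH', hδ⟩ : ∃ δ : ℝ, δ ≤ δK ∧ δ ≤ δH ∧ 0 < δ :=
    ⟨min δK δH, min_le_left _ _, min_le_right _ _, lt_min hδK hδH⟩
  obtain ⟨P₀, hP₀d, hP₀L⟩ : ∃ P₀ : Params, P₀.d = d ∧ P₀.L = L := ⟨⟨d, L, 0, 0, hd, hL⟩, rfl, rfl⟩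
  set C₀ := 2 / gamma0 L a with hC₀def
  set δ₀ := dK0 d L a m2plus with hδ₀def
  have hC₀ : 0 ≤ C₀ := by
    rw [hC₀def, ← hP₀L]; exact (div_pos two_pos (gamma0_pos (P := P₀) ha)).le
  have hδ₀ : 0 < δ₀ := by rw [hδ₀def, ← hP₀d, ← hP₀L]; exact dK0_pos (P := P₀) ha hm2
  have hL1 : (1 : ℝ) < L := by exact_mod_cast hL.2
  refine ⟨min (δ₀ / 2) (δ / 4), lt_min (by positivity) (by positivity), fun {α} hα0 hα1 => ?_⟩
  obtain ⟨c₁, hc₁, hH1⟩ := hH hα0 hα1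
  have hLα : 0 < (L : ℝ) ^ (1 - α) - 1 := by
    have := Real.one_lt_rpow hL1 (by linarith : (0 : ℝ) < 1 - α)
    linarith
  have h1 := B4Sect5Proof.latticeConst_nonneg d (show 0 ≤ δ₀ / 2 by positivity)
  have h2 := B4Sect5Proof.latticeConst_nonneg d (show 0 ≤ δ / 2 by positivity)
  have h2' := B4Sect5Proof.latticeConst_nonneg d (show 0 ≤ δ / 4 by positivity)
  have hc₁' := hc₁.le
  have h3 : 0 ≤ 1 / ((L : ℝ) ^ (1 - α) - 1) := (div_pos one_pos hLα).le
  refine ⟨4 * C₀ * Real.exp δ₀ * B4Sect5Proof.latticeConst d (δ₀ / 2) +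
      a ^ 2 * (2 * c₁ * Real.exp δ * (C ^ 2 * B4Sect5Proof.latticeConst d (δ / 2) ^ 2 *
        (Real.exp (δ / 2) * B4Sect5Proof.latticeConst d (δ / 4)))) * (1 / ((L : ℝ) ^ (1 - α) - 1)) + 1,
    by positivity, ?_⟩
  intro Q hQd hQL hK1 msq hmsq hcapm μ x₁ x₂ hne f F D hF hD0 hD₁ hD₂
  have hkm : Q.K ≤ Q.m + Q.K := Nat.le_add_left _ _
  have hcap : ∀ j, j ≤ Q.K → Q.spacing j ^ 2 * msq ≤ m2plus := by
    intro j hjK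
    have hs1 : Q.spacing j ≤ 1 := by rw [← Q.spacing_K]; exact spacing_le_spacing Q hjK
    calc Q.spacing j ^ 2 * msq ≤ 1 * msq :=
          mul_le_mul_of_nonneg_right (pow_le_one₀ (Q.spacing_pos j).le hs1) hmsq
      _ = msq := one_mul _
      _ ≤ m2plus := hcapm
  have hKB : KerBounds Q a msq Q.K C δ :=
    B4Thm19ZeroTorus.KerBounds.mono Q hC (hK Q hQd hQL msq hmsq Q.K hkm (hcap Q.K le_rfl)) le_rfl hδK'
  have hHB : ∀ j : ℕ, 1 ≤ j → j < Q.K → ∀ y : Site Q j, ((Q.L : ℝ) ^ j / T Q 0 x₁ x₂) ^ α *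
      |K1 Q a msq j μ x₂ ⟨j, y⟩ - K1 Q a msq j μ x₁ ⟨j, y⟩|
        ≤ c₁ * Real.exp (-(δ * min (dXU Q j x₁ ⟨j, y⟩) (dXU Q j x₂ ⟨j, y⟩))) := by
    intro j hj1 hjk y
    have h := hH1 Q hQd hQL msq hmsq j hj1 (hjk.le.trans hkm) (hcap j hjk.le) μ x₁ x₂ hne y
    have hM0 : 0 ≤ min (dXU Q j x₁ ⟨j, y⟩) (dXU Q j x₂ ⟨j, y⟩) :=
      le_min (dXU_nonneg Q j x₁ _) (dXU_nonneg Q j x₂ _)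
    have := mul_le_mul_of_nonneg_right hδH' hM0
    exact h.trans (mul_le_mul_of_nonneg_left (Real.exp_le_exp.mpr (by linarith)) hc₁.le)
  subst hQd hQL
  have hG0 : ∀ x x' : Site Q 0, |G0unit Q a msq x x'| ≤ C₀ * Real.exp (-(δ₀ * T Q 0 x x')) :=
    fun x x' => G0unit_decay_cap ha hmsq hcapm x x'
  have hF0 : 0 ≤ F := (abs_nonneg _).trans (hF x₁)
  have hmain := holder_row_bound Q ha hmsq hK1 le_rfl hkm hC hδ hC₀ hδ₀ hc₁.le hα0 hα1 hKB hG0 μ hne hHB f hF hD0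
    hD₁ hD₂
  exact hmain.trans (mul_le_mul_of_nonneg_right (mul_le_mul_of_nonneg_right (by linarith) (Real.exp_pos _).le) hF0)

end Torus

/-! ## §2 (2.24) for the model's propagator at `A = 0`, every level, every coupling -/

section Model

/-- A nonnegative weight times the Euclidean norm of a vector of `ℝ^N` whose weighted components are `≦ B` is `≦ √N·B`.
[cite: Balaban1982Higgs1, (1.5) p.604] -/
theorem mul_norm_le_sqrt_mul {n : ℕ} {w : ℝ} (hw : 0 ≤ w) (v : EuclideanSpace ℝ (Fin n)) {B : ℝ} (hB : 0 ≤ B)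
    (h : ∀ i, w * |v i| ≤ B) : w * ‖v‖ ≤ Real.sqrt n * B := by
  have hs : w * ‖v‖ = ‖w • v‖ := by rw [norm_smul, Real.norm_of_nonneg hw]
  rw [hs]
  refine norm_le_sqrt_mul _ hB fun i => ?_
  rw [PiLp.smul_apply, smul_eq_mul, abs_mul, abs_of_nonneg hw]
  exact h i

/-- **PROP. 2.1 (2.24), THE HÖLDER CLAUSE, FOR THE (Higgs)₂,₃ MODEL AT `A = 0`, EVERY LEVEL, `0 ≦ α < 1` — PROVED, UNIFORMLY**: for `d ≧ 1`,
odd `L > 1`, `a > 0`, `m² ≧ 0`, any `ε₀` and `N` there is `δ₀ > 0` and for every `0 ≦ α < 1` a `c₀ > 0` (*"c₀ on α also"*) such that on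
every torus of the sub-family `M·L′_μ = L^m`, for every coupling, every `1 ≦ k ≦ K` with `L^kε ≦ ε₀`, every direction `μ`, all sites `x₁ ≠ x₂`
and every `g : T_ε → ℝ^N` with `‖g‖ ≦ M` vanishing within (1.3)-distance `D ≧ 0` of `x₁` and of `x₂`:
`(|x₁ − x₂|/L^k)^{−α}·‖(D^ε_0G^ε_k(T_ε,0)g)(⟨x₂, x₂+εe_μ⟩) − (D^ε_0G^ε_k(T_ε,0)g)(⟨x₁, x₁+εe_μ⟩)‖ ≦ c₀(L^kε)e^{−δ₀D/L^k}M`, `|x₁ − x₂|` the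
torus distance (1.3) in lattice units of `T_ε` (`U(A(Γ_{x,x′})) = 1` at `A = 0`). [cite: Balaban1982Higgs1, Prop. 2.1 (2.24) p.610; (1.7) p.605] -/
theorem covDeriv_propagatorK_holder_bound (d L N : ℕ) (hd : 1 ≤ d) (hL : Odd L ∧ 1 < L) {a : ℝ} (ha : 0 < a) {msq : ℝ}
    (hmsq : 0 ≤ msq) (ε₀ : ℝ) :
    ∃ δ₀ : ℝ, 0 < δ₀ ∧ ∀ {α : ℝ}, 0 ≤ α → α < 1 → ∃ c₀ : ℝ, 0 < c₀ ∧ ∀ (P : HiggsLattice.Params) (S : Shape P), P.d = d →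
      P.L = L → ∀ (C : ChargeData N) {k : ℕ}, 1 ≤ k → k ≤ P.K → P.mesh k ≤ ε₀ →
        ∀ (g : HiggsLattice.ScalarField P 0 N) (M D : ℝ), (∀ x, ‖g x‖ ≤ M) → 0 ≤ D →
          ∀ (μ : Fin P.d) (x₁ x₂ : HiggsLattice.Site P 0), x₂ ≠ x₁ →
            (∀ z, g z ≠ 0 → D ≤ (HiggsLattice.Site.tdist x₁ z : ℝ)) → (∀ z, g z ≠ 0 → D ≤ (HiggsLattice.Site.tdist x₂ z : ℝ)) →
              (((HiggsLattice.Site.tdist x₁ x₂ : ℝ) / (P.L : ℝ) ^ k)⁻¹) ^ α *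
                  ‖covDeriv C (0 : HiggsLattice.VecField P 0)
                      (propagatorK C Finset.univ (0 : HiggsLattice.VecField P 0) msq a k g) ⟨x₂, μ⟩
                    - covDeriv C (0 : HiggsLattice.VecField P 0)
                      (propagatorK C Finset.univ (0 : HiggsLattice.VecField P 0) msq a k g) ⟨x₁, μ⟩‖
                ≤ c₀ * P.mesh k * Real.exp (-(δ₀ * (D / (P.L : ℝ) ^ k))) * M := by
  obtain ⟨δ₀, hδ₀, hT⟩ := torus_holder_decay_bound d L hd hL ha (show 0 ≤ msq * ε₀ ^ 2 by positivity)
  refine ⟨δ₀, hδ₀, fun {α} hα0 hα1 => ?_⟩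
  obtain ⟨c, hc, hG⟩ := hT hα0 hα1
  have hN0 : 0 ≤ Real.sqrt N := Real.sqrt_nonneg _
  refine ⟨(Real.sqrt N + 1) * c, mul_pos (by positivity) hc, ?_⟩
  intro P S hPd hPL C k hk1 hk hε g M D hg hD0 μ x₁ x₂ hne hD₁ hD₂
  have hℓ := P.mesh_pos k
  have hM : 0 ≤ M := (norm_nonneg _).trans (hg x₁)
  have hcap : msq * P.mesh k ^ 2 ≤ msq * ε₀ ^ 2 := mul_le_mul_of_nonneg_left (pow_le_pow_left₀ hℓ.le hε 2) hmsq
  have hE := Real.exp_nonneg (-(δ₀ * (D / (P.L : ℝ) ^ k)))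
  -- the support conditions and the distance read on the level-`k` torus
  have hDS : ∀ (x : HiggsLattice.Site P 0), (∀ z, g z ≠ 0 → D ≤ (HiggsLattice.Site.tdist x z : ℝ)) →
      ∀ (i : Fin N) (z : Site (setupAt S k) 0), cmpAt S hk i g z ≠ 0 → D ≤ T (setupAt S k) 0 (eSiteAt S hk (Nat.zero_le _) x) z := by
    intro x hD i z hz
    rw [T_eq_tdist_symm S hk (Nat.zero_le _), Equiv.symm_apply_apply]
    refine hD _ fun h0 => hz ?_
    rw [cmpAt_apply, h0]
    rfl
  have hne' : eSiteAt S hk (Nat.zero_le _) x₂ ≠ eSiteAt S hk (Nat.zero_le _) x₁ :=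
    fun h => hne ((eSiteAt S hk (Nat.zero_le _)).injective h)
  have hdist : (HiggsLattice.Site.tdist x₁ x₂ : ℝ) / (P.L : ℝ) ^ k
      = (setupAt S k).eps * T (setupAt S k) 0 (eSiteAt S hk (Nat.zero_le _) x₁) (eSiteAt S hk (Nat.zero_le _) x₂) := by
    rw [T_eSiteAt S hk (Nat.zero_le _), eps_setupAt_mul]
  have hw : 0 ≤ (((HiggsLattice.Site.tdist x₁ x₂ : ℝ) / (P.L : ℝ) ^ k)⁻¹) ^ α :=
    Real.rpow_nonneg (inv_nonneg.2 (div_nonneg (Nat.cast_nonneg _) (pow_nonneg (Nat.cast_nonneg _) _))) α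
  subst hPd
  -- component by component
  have hcomp : ∀ i : Fin N,
      (((HiggsLattice.Site.tdist x₁ x₂ : ℝ) / (P.L : ℝ) ^ k)⁻¹) ^ α *
        |(covDeriv C (0 : HiggsLattice.VecField P 0)
              (propagatorK C Finset.univ (0 : HiggsLattice.VecField P 0) msq a k g) ⟨x₂, μ⟩
            - covDeriv C (0 : HiggsLattice.VecField P 0)
              (propagatorK C Finset.univ (0 : HiggsLattice.VecField P 0) msq a k g) ⟨x₁, μ⟩) i|
        ≤ P.mesh k * (c * Real.exp (-(δ₀ * (D / (P.L : ℝ) ^ k))) * M) := by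
    intro i
    rw [PiLp.sub_apply, covDeriv_zero, covDeriv_zero, sderiv_propagatorK_apply_at S hk C hk1 ha hmsq,
      sderiv_propagatorK_apply_at S hk C hk1 ha hmsq, ← mul_sub, abs_mul, abs_of_pos hℓ, ← mul_assoc, mul_comm _ (P.mesh k),
      mul_assoc]
    refine mul_le_mul_of_nonneg_left ?_ hℓ.le
    have h := hG (setupAt S k) rfl hPL hk1 (msq * P.mesh k ^ 2) (mul_nonneg hmsq (sq_nonneg _)) hcap μ
      (eSiteAt S hk (Nat.zero_le _) x₁) (eSiteAt S hk (Nat.zero_le _) x₂) hne' (cmpAt S hk i g) M D (abs_cmpAt_le S hk hg i) hD0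
      (fun z hz => hDS x₁ hD₁ i z hz) (fun z hz => hDS x₂ hD₂ i z hz)
    rwa [← hdist, eps_setupAt_mul] at h
  calc (((HiggsLattice.Site.tdist x₁ x₂ : ℝ) / (P.L : ℝ) ^ k)⁻¹) ^ α *
        ‖covDeriv C (0 : HiggsLattice.VecField P 0)
            (propagatorK C Finset.univ (0 : HiggsLattice.VecField P 0) msq a k g) ⟨x₂, μ⟩
          - covDeriv C (0 : HiggsLattice.VecField P 0)
            (propagatorK C Finset.univ (0 : HiggsLattice.VecField P 0) msq a k g) ⟨x₁, μ⟩‖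
      ≤ Real.sqrt N * (P.mesh k * (c * Real.exp (-(δ₀ * (D / (P.L : ℝ) ^ k))) * M)) :=
        mul_norm_le_sqrt_mul hw _ (by positivity) hcomp
    _ ≤ (Real.sqrt N + 1) * (P.mesh k * (c * Real.exp (-(δ₀ * (D / (P.L : ℝ) ^ k))) * M)) :=
        mul_le_mul_of_nonneg_right (by linarith) (by positivity)
    _ = (Real.sqrt N + 1) * c * P.mesh k * Real.exp (-(δ₀ * (D / (P.L : ℝ) ^ k))) * M := by ring

end Model

end Literature.MathematicalPhysics.QuantumFieldTheory.Balaban1983to89.B1Ineq224ZeroFieldTorus
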